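import Literature.Topology.PlaneTopology.ArcRetractionPush
import Literature.Topology.PlaneTopology.JordanDomainLocalJoin
import HarnessLib

/-!
# A Jordan loop around a corner of a Jordan domain traverses it between the two adjacent arcs

Topic: Topology / PlaneTopology.  Let `Ω` be a Jordan domain with boundary loop `b` and three
boundary parameters `m₁ < m < m₃ < m₁ + 1`, cutting the boundary curve into the arcs
`A₁ = b[m₁, m]`, `A₂ = b[m, m₃]` (adjacent at the corner `c = b m`) and `A₀ = b[m₃, m₁ + 1]`.
Let `Γ` be a Jordan loop (`IsJordanLoop`) with `c` in its inside and `A₀` in its outside.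

* `exists_mem_mem_forall_uIcc_of_inside` — **`Γ` traverses `closure Ω` from `A₁` to `A₂`**: if
  moreover `Γ 0 ∉ closure Ω`, there are times `s, t ∈ [0, 1]` with `Γ s ∈ A₁`, `Γ t ∈ A₂` and
  `Γ [s, t] ⊆ closure Ω` (in either order of `s, t`).

This is the continuum-topology input of "a black circuit around the corner `A_{i+1} ∩ A_{i+2}`
contains a black path in `closure Ω` from `A_{i+1}` to `A_{i+2}`" in the proof of the approximate
equicontinuity of separating probabilities (Bollobás–Riordan, *Percolation* (2006), Ch. 7, proof
of Claim 22, p. 198), for general Jordan domains.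

Proof (by contradiction).  The disc times `T = {t ∈ [0,1] : Γ t ∈ closure Ω}` split into the
label sets `Z_ℓ` = times connected inside `T` to a time at which `Γ ∈ A_ℓ` (`ℓ = 1, 2`); every
disc time is labelled (the last exit time before it is a contact time, on `A₁ ∪ A₂` since `A₀`
misses `Γ`), the `Z_ℓ` are closed (compactness), and they are disjoint exactly when no traverse
exists.  All contacts of label `ℓ` lie on a sub-arc `Â_ℓ ⊆ A_ℓ` avoiding `c` and a point
`a ∈ A₀`.  Transport by a Schoenflies homeomorphism `H` of `ℂ` with `H(𝔻̄) = closure Ω`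
(`exists_schoenflies`): the push lemma `wind_sub_eq_of_push` (`ArcRetractionPush.lean`), with the
retractions of the plane onto `H⁻¹(Â_ℓ)` (`exists_retraction_onto_arc`), gives equal winding
numbers of `H⁻¹ ∘ Γ` about `H⁻¹ c` (inside: non-zero) and `H⁻¹ a` (outside: zero) — absurd.

## References
* B. Bollobás, O. Riordan, *Percolation*, CUP (2006), Ch. 7 p. 198. [BollobasRiordan2006]
* Ch. Pommerenke, *Boundary Behaviour of Conformal Maps* (1992), §2.3 Cor. 2.8. [PommerenkeBBCM1992]
-/

noncomputable section

namespace Literature.Topology.PlaneTopology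

open Set Metric Filter Function _root_.Topology
open Literature.Probability.RandomPlanarGeometry

/-! ### Elementary facts -/

/-- A point of `uIcc t s` is a convex combination `(1 - θ) t + θ s`, `θ ∈ [0, 1]`. [folklore] -/
theorem mem_uIcc_iff_exists_combo {t s x : ℝ} :
    x ∈ uIcc t s ↔ ∃ θ ∈ Icc (0 : ℝ) 1, (1 - θ) * t + θ * s = x := by
  rw [← segment_eq_uIcc, segment_eq_image]
  simp only [smul_eq_mul, mem_image]

/-- Above a compact set of reals inside `[α, β]` missing `β` there is room below `β`. [folklore] -/
theorem exists_mem_Ico_forall_le {P : Set ℝ} (hP : IsCompact P) {α β : ℝ} (hαβ : α < β)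
    (hPI : P ⊆ Icc α β) (hβ : β ∉ P) : ∃ β' ∈ Ico α β, ∀ θ ∈ P, θ ≤ β' := by
  rcases P.eq_empty_or_nonempty with rfl | hne
  · exact ⟨α, ⟨le_rfl, hαβ⟩, fun θ hθ => hθ.elim⟩
  · have hmem : sSup P ∈ P := hP.sSup_mem hne
    refine ⟨sSup P, ⟨(hPI hmem).1, lt_of_le_of_ne (hPI hmem).2 fun h => hβ (h ▸ hmem)⟩,
      fun θ hθ => le_csSup hP.bddAbove hθ⟩

/-- Below a compact set of reals inside `[α, β]` missing `α` there is room above `α`. [folklore] -/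
theorem exists_mem_Ioc_forall_ge {P : Set ℝ} (hP : IsCompact P) {α β : ℝ} (hαβ : α < β)
    (hPI : P ⊆ Icc α β) (hα : α ∉ P) : ∃ α' ∈ Ioc α β, ∀ θ ∈ P, α' ≤ θ := by
  rcases P.eq_empty_or_nonempty with rfl | hne
  · exact ⟨β, ⟨hαβ, le_rfl⟩, fun θ hθ => hθ.elim⟩
  · have hmem : sInf P ∈ P := hP.sInf_mem hne
    refine ⟨sInf P, ⟨lt_of_le_of_ne (hPI hmem).1 fun h => hα (h.symm ▸ hmem), (hPI hmem).2⟩,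
      fun θ hθ => csInf_le hP.bddBelow hθ⟩

/-! ### The traverse -/

section Traverse

variable (J : JordanDomain) {m₁ m m₃ : ℝ} {Γ : ℝ → ℂ}

/-- The boundary curve split at three parameters `m₁ ≤ m ≤ m₃ ≤ m₁ + 1`. [folklore] -/
theorem frontier_eq_union_three (h₁ : m₁ ≤ m) (h₂ : m ≤ m₃) :
    frontier J.carrier = J.boundary '' Icc m₁ m ∪ J.boundary '' Icc m m₃ ∪
      J.boundary '' Icc m₃ (m₁ + 1) := by
  rw [J.frontier_eq_union_image_boundary m₁ m₃, ← Icc_union_Icc_eq_Icc h₁ h₂, image_union]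

/-- **Label sets are closed.**  For a compact set `C ⊆ [0, 1]` of times, the set of times
`t ∈ [0, 1]` joined to some `s ∈ C` by a parameter interval mapped into the closed set `F` is
closed (it is the projection of a compact subset of `[0, 1] × C`). [folklore] -/
theorem isClosed_labelSet (hΓc : Continuous Γ) {F : Set ℂ} (hF : IsClosed F) {C : Set ℝ}
    (hC : IsCompact C) :
    IsClosed {t | t ∈ Icc (0 : ℝ) 1 ∧ ∃ s ∈ C, ∀ x ∈ uIcc t s, Γ x ∈ F} := by
  set Q : Set (ℝ × ℝ) := {q | q ∈ Icc (0 : ℝ) 1 ×ˢ C ∧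
    ∀ μ ∈ Icc (0 : ℝ) 1, Γ ((1 - μ) * q.1 + μ * q.2) ∈ F} with hQ
  have hQc : IsCompact Q := by
    refine (isCompact_Icc.prod hC).of_isClosed_subset ?_ fun q hq => hq.1
    have e : Q = Icc (0 : ℝ) 1 ×ˢ C ∩ ⋂ μ ∈ Icc (0 : ℝ) 1,
        (fun q : ℝ × ℝ => Γ ((1 - μ) * q.1 + μ * q.2)) ⁻¹' F := by
      ext q
      simp only [hQ, mem_setOf_eq, mem_inter_iff, mem_iInter, mem_preimage]
    rw [e]
    exact (isClosed_Icc.prod hC.isClosed).inter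
      (isClosed_biInter fun μ _ => hF.preimage (by fun_prop))
  have heq : {t | t ∈ Icc (0 : ℝ) 1 ∧ ∃ s ∈ C, ∀ x ∈ uIcc t s, Γ x ∈ F} = Prod.fst '' Q := by
    ext t
    constructor
    · rintro ⟨ht, s, hs, hseg⟩
      refine ⟨(t, s), ⟨⟨ht, hs⟩, fun μ hμ => hseg _ ?_⟩, rfl⟩
      exact mem_uIcc_iff_exists_combo.2 ⟨μ, hμ, rfl⟩
    · rintro ⟨⟨t, s⟩, ⟨⟨ht, hs⟩, hseg⟩, rfl⟩
      refine ⟨ht, s, hs, fun x hx => ?_⟩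
      obtain ⟨μ, hμ, rfl⟩ := mem_uIcc_iff_exists_combo.1 hx
      exact hseg μ hμ
  rw [heq]
  exact (hQc.image continuous_fst).isClosed

/-- **Every disc time is labelled.**  If `Γ 0 ∉ closure Ω` and `Γ t ∈ closure Ω` (`t ∈ [0, 1]`),
the last time `u ≤ t` adherent to the exterior times is a frontier time with `Γ [u, t] ⊆ closure Ω`.
[folklore] -/
theorem exists_frontier_time_le (hΓc : Continuous Γ) (h0 : Γ 0 ∉ closure J.carrier) {t : ℝ}
    (ht : t ∈ Icc (0 : ℝ) 1) (htcl : Γ t ∈ closure J.carrier) :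
    ∃ u ∈ Icc (0 : ℝ) 1, Γ u ∈ frontier J.carrier ∧ ∀ x ∈ uIcc t u, Γ x ∈ closure J.carrier := by
  set B : Set ℝ := {x | x ∈ Icc 0 t ∧ Γ x ∉ closure J.carrier} with hB
  have hB0 : (0 : ℝ) ∈ B := ⟨⟨le_rfl, ht.1⟩, h0⟩
  have hBbdd : BddAbove B := ⟨t, fun x hx => hx.1.2⟩
  set u := sSup B with hu
  have hu0 : 0 ≤ u := le_csSup hBbdd hB0
  have hut : u ≤ t := csSup_le ⟨0, hB0⟩ fun x hx => hx.1.2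
  have huT : Γ u ∈ closure J.carrier := by
    by_contra huo
    have hopen : IsOpen (Γ ⁻¹' (closure J.carrier)ᶜ) :=
      isClosed_closure.isOpen_compl.preimage hΓc
    obtain ⟨ε, hε, hεsub⟩ := Metric.isOpen_iff.1 hopen u huo
    have hult : u < t := lt_of_le_of_ne hut fun h => huo (h ▸ htcl)
    set x := min (u + ε / 2) t with hx
    have hux : u < x := lt_min (by linarith) hult
    have hxB : x ∈ B := by
      refine ⟨⟨hu0.trans hux.le, min_le_right _ _⟩, hεsub ?_⟩
      rw [mem_ball, Real.dist_eq, abs_lt]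
      constructor <;> linarith [min_le_left (u + ε / 2) t]
    exact (not_le.2 hux) (le_csSup hBbdd hxB)
  have hucl : Γ u ∈ closure (closure J.carrier)ᶜ := by
    have hu_mem : u ∈ closure B := csSup_mem_closure ⟨0, hB0⟩ hBbdd
    have : Γ u ∈ closure (Γ '' B) :=
      image_closure_subset_closure_image hΓc ⟨u, hu_mem, rfl⟩
    refine closure_mono ?_ this
    rintro _ ⟨x, hx, rfl⟩
    exact hx.2
  have hufr : Γ u ∈ frontier J.carrier := by
    have : Γ u ∈ frontier (closure J.carrier) := by
      rw [frontier_eq_closure_inter_closure, closure_closure]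
      exact ⟨huT, hucl⟩
    exact frontier_closure_subset this
  refine ⟨u, ⟨hu0, hut.trans ht.2⟩, hufr, fun x hx => ?_⟩
  rw [uIcc_of_ge hut] at hx
  by_contra hxo
  rcases eq_or_lt_of_le hx.1 with hxu | hxu
  · exact hxo (hxu ▸ huT)
  · exact (not_le.2 hxu) (le_csSup hBbdd ⟨⟨hu0.trans hx.1, hx.2⟩, hxo⟩)

/-- **A Jordan loop around a corner traverses the closed domain between the adjacent arcs**
(see the module docstring): with `A₁ = b[m₁, m]`, `A₂ = b[m, m₃]`, `A₀ = b[m₃, m₁ + 1]`,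
`m₁ < m < m₃ < m₁ + 1`, a Jordan loop `Γ` starting off `closure Ω`, with the corner `b m` inside
and `A₀` outside, has times `s, t ∈ [0, 1]` with `Γ s ∈ A₁`, `Γ t ∈ A₂`, `Γ (uIcc s t) ⊆ closure Ω`.
[cite: BollobasRiordan2006, Ch. 7 p. 198 (proof of Claim 22)] -/
theorem exists_mem_mem_forall_uIcc_of_inside (h₁ : m₁ < m) (h₂ : m < m₃) (h₃ : m₃ < m₁ + 1)
    (hΓ : IsJordanLoop Γ) (h0 : Γ 0 ∉ closure J.carrier)
    (hin : J.boundary m ∈ IsJordanLoop.inside Γ)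
    (hout : J.boundary '' Icc m₃ (m₁ + 1) ⊆ IsJordanLoop.outside Γ) :
    ∃ s ∈ Icc (0 : ℝ) 1, ∃ t ∈ Icc (0 : ℝ) 1, Γ s ∈ J.boundary '' Icc m₁ m ∧
      Γ t ∈ J.boundary '' Icc m m₃ ∧ ∀ x ∈ uIcc s t, Γ x ∈ closure J.carrier := by
  by_contra hcon
  push Not at hcon
  -- notation
  set b := J.boundary with hb
  set A₁ : Set ℂ := b '' Icc m₁ m with hA₁
  set A₂ : Set ℂ := b '' Icc m m₃ with hA₂
  set A₀ : Set ℂ := b '' Icc m₃ (m₁ + 1) with hA₀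
  have hA₁c : IsCompact A₁ := isCompact_Icc.image J.continuous_boundary
  have hA₂c : IsCompact A₂ := isCompact_Icc.image J.continuous_boundary
  have hfront : frontier J.carrier = A₁ ∪ A₂ ∪ A₀ := frontier_eq_union_three J h₁.le h₂.le
  have hA₀Γ : ∀ p ∈ A₀, p ∉ range Γ := fun p hp => (hout hp).1
  have hcΓ : b m ∉ range Γ := hin.1
  have hinj : InjOn b (Ico m₁ (m₁ + 1)) := J.injOn_boundary_Ico m₁
  -- the exceptional point `a ∈ A₀`
  set θa : ℝ := (m₃ + (m₁ + 1)) / 2 with hθa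
  have hθa₁ : m₃ < θa := by rw [hθa]; linarith
  have hθa₂ : θa < m₁ + 1 := by rw [hθa]; linarith
  have haA₀ : b θa ∈ A₀ := ⟨θa, ⟨hθa₁.le, hθa₂.le⟩, rfl⟩
  have haΓ : b θa ∉ range Γ := hA₀Γ _ haA₀
  -- contact parameters on `A₁`, `A₂` keep away from the corner
  set P₁ : Set ℝ := {θ | θ ∈ Icc m₁ m ∧ b θ ∈ range Γ} with hP₁
  set P₂ : Set ℝ := {θ | θ ∈ Icc m m₃ ∧ b θ ∈ range Γ} with hP₂
  have hPc : ∀ u v : ℝ, IsCompact {θ | θ ∈ Icc u v ∧ b θ ∈ range Γ} := fun u v =>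
    isCompact_Icc.inter_right (hΓ.isCompact_range.isClosed.preimage J.continuous_boundary)
  obtain ⟨m₁', hm₁', hP₁le⟩ := exists_mem_Ico_forall_le (hPc m₁ m) h₁ (fun θ hθ => hθ.1)
    (fun h => hcΓ h.2)
  obtain ⟨m₃', hm₃', hP₂ge⟩ := exists_mem_Ioc_forall_ge (hPc m m₃) h₂ (fun θ hθ => hθ.1)
    (fun h => hcΓ h.2)
  set Â₁ : Set ℂ := b '' Icc m₁ m₁' with hÂ₁
  set Â₂ : Set ℂ := b '' Icc m₃' m₃ with hÂ₂
  have hÂ₁sub : ∀ p ∈ A₁, p ∈ range Γ → p ∈ Â₁ := by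
    rintro _ ⟨θ, hθ, rfl⟩ hθΓ
    exact ⟨θ, ⟨hθ.1, hP₁le θ ⟨hθ, hθΓ⟩⟩, rfl⟩
  have hÂ₂sub : ∀ p ∈ A₂, p ∈ range Γ → p ∈ Â₂ := by
    rintro _ ⟨θ, hθ, rfl⟩ hθΓ
    exact ⟨θ, ⟨hP₂ge θ ⟨hθ, hθΓ⟩, hθ.2⟩, rfl⟩
  have hcÂ₁ : b m ∉ Â₁ := by
    rintro ⟨θ, hθ, hθm⟩
    have := hinj ⟨hθ.1, by linarith [hθ.2, hm₁'.2]⟩ ⟨h₁.le, by linarith⟩ hθm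
    linarith [hθ.2, hm₁'.2]
  have hcÂ₂ : b m ∉ Â₂ := by
    rintro ⟨θ, hθ, hθm⟩
    have := hinj ⟨by linarith [hθ.1, hm₃'.1], by linarith [hθ.2]⟩ ⟨h₁.le, by linarith⟩ hθm
    linarith [hθ.1, hm₃'.1]
  have haÂ₁ : b θa ∉ Â₁ := by
    rintro ⟨θ, hθ, hθm⟩
    have := hinj ⟨hθ.1, by linarith [hθ.2, hm₁'.2]⟩ ⟨by linarith, hθa₂⟩ hθm
    linarith [hθ.2, hm₁'.2]
  have haÂ₂ : b θa ∉ Â₂ := by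
    rintro ⟨θ, hθ, hθm⟩
    have := hinj ⟨by linarith [hθ.1, hm₃'.1], by linarith [hθ.2]⟩ ⟨by linarith, hθa₂⟩ hθm
    linarith [hθ.2]
  -- label sets
  set C₁ : Set ℝ := Icc 0 1 ∩ Γ ⁻¹' A₁ with hC₁
  set C₂ : Set ℝ := Icc 0 1 ∩ Γ ⁻¹' A₂ with hC₂
  have hC₁c : IsCompact C₁ := isCompact_Icc.inter_right (hA₁c.isClosed.preimage hΓ.continuous)
  have hC₂c : IsCompact C₂ := isCompact_Icc.inter_right (hA₂c.isClosed.preimage hΓ.continuous)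
  set Z₁ : Set ℝ := {t | t ∈ Icc (0 : ℝ) 1 ∧ ∃ s ∈ C₁, ∀ x ∈ uIcc t s, Γ x ∈ closure J.carrier}
    with hZ₁
  set Z₂ : Set ℝ := {t | t ∈ Icc (0 : ℝ) 1 ∧ ∃ s ∈ C₂, ∀ x ∈ uIcc t s, Γ x ∈ closure J.carrier}
    with hZ₂
  have hZ₁c : IsClosed Z₁ := isClosed_labelSet hΓ.continuous isClosed_closure hC₁c
  have hZ₂c : IsClosed Z₂ := isClosed_labelSet hΓ.continuous isClosed_closure hC₂c
  have hZ₁K : ∀ t ∈ Z₁, Γ t ∈ closure J.carrier := fun t ⟨_, s, _, h⟩ => h t left_mem_uIcc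
  have hZ₂K : ∀ t ∈ Z₂, Γ t ∈ closure J.carrier := fun t ⟨_, s, _, h⟩ => h t left_mem_uIcc
  have hdisj : Disjoint Z₁ Z₂ := by
    rw [Set.disjoint_left]
    rintro t ⟨-, s₁, ⟨hs₁I, hs₁A⟩, hseg₁⟩ ⟨-, s₂, ⟨hs₂I, hs₂A⟩, hseg₂⟩
    obtain ⟨x, hx, hxo⟩ := hcon s₁ hs₁I s₂ hs₂I hs₁A hs₂A
    rcases uIcc_subset_uIcc_union_uIcc (b := t) hx with h | h
    · exact hxo (hseg₁ x (uIcc_comm s₁ t ▸ h))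
    · exact hxo (hseg₂ x h)
  have hcover : ∀ t ∈ Icc (0 : ℝ) 1, Γ t ∈ closure J.carrier → t ∈ Z₁ ∪ Z₂ := by
    intro t ht htcl
    obtain ⟨u, huI, hufr, hseg⟩ := exists_frontier_time_le J hΓ.continuous h0 ht htcl
    rw [hfront] at hufr
    rcases hufr with (h | h) | h
    · exact Or.inl ⟨ht, u, ⟨huI, h⟩, hseg⟩
    · exact Or.inr ⟨ht, u, ⟨huI, h⟩, hseg⟩
    · exact absurd (mem_range_self u) (hA₀Γ _ h)
  have hself : ∀ {t : ℝ}, t ∈ Icc (0 : ℝ) 1 → Γ t ∈ closure J.carrier →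
      ∀ x ∈ uIcc t t, Γ x ∈ closure J.carrier := fun {t} _ htcl x hx => by
    rw [uIcc_self, mem_singleton_iff] at hx
    exact hx ▸ htcl
  have hZ₁S : ∀ t ∈ Z₁, Γ t ∈ frontier J.carrier → Γ t ∈ Â₁ := by
    intro t ht htfr
    have htcl := hZ₁K t ht
    rw [hfront] at htfr
    rcases htfr with (h | h) | h
    · exact hÂ₁sub _ h (mem_range_self t)
    · exact absurd (Or.inr ⟨ht.1, t, ⟨ht.1, h⟩, hself ht.1 htcl⟩ : t ∈ Z₁ ∪ Z₂)
        (fun h' => h'.elim (fun _ => Set.disjoint_left.1 hdisj ht ⟨ht.1, t, ⟨ht.1, h⟩,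
          hself ht.1 htcl⟩) (fun h2 => Set.disjoint_left.1 hdisj ht h2))
    · exact absurd (mem_range_self t) (hA₀Γ _ h)
  have hZ₂S : ∀ t ∈ Z₂, Γ t ∈ frontier J.carrier → Γ t ∈ Â₂ := by
    intro t ht htfr
    have htcl := hZ₂K t ht
    rw [hfront] at htfr
    rcases htfr with (h | h) | h
    · exact absurd ht (fun h2 => Set.disjoint_left.1 hdisj ⟨ht.1, t, ⟨ht.1, h⟩,
        hself ht.1 htcl⟩ h2)
    · exact hÂ₂sub _ h (mem_range_self t)
    · exact absurd (mem_range_self t) (hA₀Γ _ h)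
  -- Schoenflies transport
  obtain ⟨H, -, hsphere, hcl⟩ := exists_schoenflies J
  have hKiff : ∀ p : ℂ, H.symm p ∈ closedBall (0 : ℂ) 1 ↔ p ∈ closure J.carrier := fun p => by
    rw [← hcl, H.image_eq_preimage_symm]
    rfl
  have hSiff : ∀ p : ℂ, H.symm p ∈ sphere (0 : ℂ) 1 ↔ p ∈ frontier J.carrier := fun p => by
    rw [← hsphere, H.image_eq_preimage_symm]
    rfl
  set Γ' : ℝ → ℂ := H.symm ∘ Γ with hΓ'
  have hΓ'J : IsJordanLoop Γ' := hΓ.comp_homeomorph H.symm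
  have hrange' : ∀ p : ℂ, H.symm p ∈ range Γ' ↔ p ∈ range Γ := fun p => by
    rw [hΓ', IsJordanLoop.range_comp_homeomorph, H.symm.injective.mem_set_image]
  set c' := H.symm (b m) with hc'
  set a' := H.symm (b θa) with ha'
  have hc'in : c' ∈ IsJordanLoop.inside Γ' := (hΓ.mem_inside_comp_homeomorph_iff H.symm).2 hin
  have ha'out : a' ∈ IsJordanLoop.outside Γ' :=
    (hΓ.mem_outside_comp_homeomorph_iff H.symm).2 (hout haA₀)
  have hc'Γ : c' ∉ range Γ' := fun h => hcΓ ((hrange' _).1 h)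
  have ha'Γ : a' ∉ range Γ' := fun h => haΓ ((hrange' _).1 h)
  have hwc : wind (fun t => Γ' t - c') ≠ 0 := (hΓ'J.mem_inside_iff_wind_ne_zero hc'Γ).1 hc'in
  have hwa : wind (fun t => Γ' t - a') = 0 := (hΓ'J.mem_outside_iff_wind_eq_zero ha'Γ).1 ha'out
  -- retracts
  set f : ℝ → ℂ := H.symm ∘ b with hf
  have hfc : Continuous f := H.symm.continuous.comp J.continuous_boundary
  have hfinj : ∀ {u v : ℝ}, v < u + 1 → InjOn f (Icc u v) := fun {u v} huv =>
    H.symm.injective.comp_injOn (J.injOn_boundary_Icc huv)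
  obtain ⟨π₁, hπ₁c, hπ₁R, hπ₁id⟩ := exists_retraction_onto_arc hfc hm₁'.1
    (hfinj (by linarith [hm₁'.2]))
  obtain ⟨π₂, hπ₂c, hπ₂R, hπ₂id⟩ := exists_retraction_onto_arc hfc hm₃'.2
    (hfinj (by linarith [hm₃'.1]))
  have hRiff : ∀ (u v : ℝ) (p : ℂ), H.symm p ∈ f '' Icc u v ↔ p ∈ b '' Icc u v := fun u v p => by
    rw [hf, image_comp, H.symm.injective.mem_set_image]
  have hRS : ∀ u v : ℝ, f '' Icc u v ⊆ sphere (0 : ℂ) 1 := by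
    rintro u v _ ⟨θ, -, rfl⟩
    exact (hSiff _).2 (J.boundary_mem_frontier θ)
  have hRc : ∀ u v : ℝ, IsCompact (f '' Icc u v) := fun u v => isCompact_Icc.image hfc
  -- apply the push lemma
  refine hwc (hwa ▸ wind_sub_eq_of_push (Γ := Γ') hΓ'J.continuous hΓ'J.eq_zero_one
    (fun h => h0 ((hKiff _).1 h)) (hRc m₁ m₁') (hRc m₃' m₃) (hRS m₁ m₁') (hRS m₃' m₃)
    hπ₁c hπ₂c hπ₁R hπ₂R hπ₁id hπ₂id hZ₁c hZ₂c (fun t ht => ht.1) (fun t ht => ht.1) hdisj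
    (fun t ht htK => hcover t ht ((hKiff _).1 htK))
    (fun t ht => (hKiff _).2 (hZ₁K t ht)) (fun t ht => (hKiff _).2 (hZ₂K t ht))
    (fun t ht hn => (hRiff _ _ _).2 (hZ₁S t ht ((hSiff _).1 (mem_sphere_zero_iff_norm.2 hn))))
    (fun t ht hn => (hRiff _ _ _).2 (hZ₂S t ht ((hSiff _).1 (mem_sphere_zero_iff_norm.2 hn))))
    (mem_sphere_zero_iff_norm.1 ((hSiff _).2 (J.boundary_mem_frontier m)))
    (mem_sphere_zero_iff_norm.1 ((hSiff _).2 (J.boundary_mem_frontier θa)))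
    (fun h => hcÂ₁ ((hRiff _ _ _).1 h)) (fun h => hcÂ₂ ((hRiff _ _ _).1 h))
    (fun h => haÂ₁ ((hRiff _ _ _).1 h)) (fun h => haÂ₂ ((hRiff _ _ _).1 h)) hc'Γ ha'Γ)

end Traverse

end Literature.Topology.PlaneTopology
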